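import Literature.NumberTheory.Sieve.HeathBrownCubicTypeIISsum
import Literature.NumberTheory.Sieve.HeathBrownCubicLemma111
import Literature.NumberTheory.Sieve.HeathBrownCubicTypeIIReduction
import HarnessLib

/-!
# Heath-Brown's Lemma 3.10: the Type II estimate (proof)

D. R. Heath-Brown, *Primes represented by `x³ + 2y³`*, Acta Math. 186 (2001), **Lemma 3.10** (p. 17),
proved in §§11–13 (Lemma 12.2 and §13 p. 83, (13.7)):

> "whence Lemma 12.2 yields `S_V ≪ X²(Y^{−1/2} + Y³⁰X^{−τ/4} + Y⁸Q₁^{−1/8} + Y⁸Q₁² exp{−c√(log L)})(log X)^c`.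
> We therefore choose `Y = Q₁^{1/80}`, which is in accordance with (11.8), and deduce that
> `S_V ≪ X²Q₁^{−1/160}(log X)^c` … It follows that Lemma 3.10 holds."

We assemble the PROVED bricks: `S_V = main + error` (`bilin_eq_main_add_error`), Cauchy
(`abs_sum_cA_innerSum_le`), the bound for `S = S₁ + S₂` (`Ssum_le_of_params`), the error term
(`exists_errorEV_bound`), giving `SV_le_of_params`; then the parameter inequalities are verified for
`X ≥ X₀(ϖ, c₁, c₅, c₆)` and the reduction `HeathBrown2001_lemma_3_10_of_SV_bound` (the choice
`Y = Q₁^{1/80}`) yields `HeathBrown2001_lemma_3_10_holds`.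

## References

* D. R. Heath-Brown, *Primes represented by `x³ + 2y³`*, Acta Math. 186 (2001), Lemma 3.10, Lemma 12.2,
  §13 p. 83. [cite: HeathBrownActa2001, Lemma 3.10]

## Mathlib / tree search

Tree: `HeathBrownCubicTypeIISsum`, `HeathBrownCubicTypeIIErrorEV`, `HeathBrownCubicTypeIICauchy`,
`HeathBrownCubicLemma111`, `HeathBrownCubicLemma45Pow`, `HeathBrownCubicTypeIITail`,
`HeathBrownCubicTypeIIReduction` (`HeathBrown2001_lemma_3_10_of_SV_bound`, `eventually_loglog_rpow_le`).
-/

noncomputable section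

open Finset NumberField Filter

namespace Literature.NumberTheory.Sieve.CubicSieve

open LFunctions.CubeRootTwoField CubicPrimes LargeSieve

/-! ### Square roots of the four terms -/

/-- `u₁ + u₂ + u₃ + u₄ ≤ (t₁ + t₂ + t₃ + t₄)²` when `uᵢ = tᵢ²`, `tᵢ ≥ 0`; hence `√U ≤ ∑ tᵢ`. [folklore] -/
theorem sqrt_sum_four_le {t₁ t₂ t₃ t₄ : ℝ} (h₁ : 0 ≤ t₁) (h₂ : 0 ≤ t₂) (h₃ : 0 ≤ t₃) (h₄ : 0 ≤ t₄) :
    Real.sqrt (t₁ ^ 2 + t₂ ^ 2 + t₃ ^ 2 + t₄ ^ 2) ≤ t₁ + t₂ + t₃ + t₄ := by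
  rw [Real.sqrt_le_left (by positivity)]
  nlinarith [mul_nonneg h₁ h₂, mul_nonneg h₁ h₃, mul_nonneg h₁ h₄, mul_nonneg h₂ h₃, mul_nonneg h₂ h₄, mul_nonneg h₃ h₄]

/-- The squares of the four target terms: `(Y^{−1/2})² = Y⁻¹`, `(Y³⁰X^{−τ/4})² = Y⁶⁰X^{−τ/2}`,
`(Y⁸Q₁^{−1/8})² = Y¹⁶Q₁^{−1/4}`, `(Y⁸Q₁²e^{−u/2})² = Y¹⁶Q₁⁴e^{−u}`. [folklore] -/
theorem four_terms_sq {X Y Q₁ τ c u : ℝ} (hX : 0 < X) (hY : 0 < Y) (hQ₁ : 0 < Q₁) :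
    (Y ^ (-(1 / 2 : ℝ))) ^ 2 = Y⁻¹ ∧ (Y ^ 30 * X ^ (-(τ / 4))) ^ 2 = Y ^ 60 * X ^ (-(τ / 2)) ∧
      (Y ^ 8 * Q₁ ^ (-(1 / 8 : ℝ))) ^ 2 = Y ^ 16 * Q₁ ^ (-(1 / 4 : ℝ)) ∧
      (Y ^ 8 * Q₁ ^ 2 * Real.exp (-(c / 2 * u))) ^ 2 = Y ^ 16 * Q₁ ^ 4 * Real.exp (-(c * u)) := by
  refine ⟨?_, ?_, ?_, ?_⟩
  · rw [← Real.rpow_natCast, ← Real.rpow_mul hY.le, ← Real.rpow_neg_one]; norm_num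
  · rw [mul_pow, ← Real.rpow_natCast (X ^ _), ← Real.rpow_mul hX.le]; ring_nf
  · rw [mul_pow, ← Real.rpow_natCast (Q₁ ^ _), ← Real.rpow_mul hQ₁.le]; ring_nf
  · rw [mul_pow, mul_pow, ← Real.exp_nat_mul (-(c / 2 * u)) 2]; ring_nf

/-! ### The bound for `S_V` under the parameter inequalities -/

set_option maxHeartbeats 1600000 in
open scoped Classical in
/-- **Lemma 12.2 with §13**: under the parameter inequalities of `Ssum_le_of_params` (and `c` of
`CSupport`), `|S_V| ≤ K·X²·(Y^{−1/2} + Y³⁰X^{−τ/4} + Y⁸Q₁^{−1/8} + Y⁸Q₁²e^{−(c₁/2)√(log L)})(log X)^{c₀}`,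
with `c₀` ABSOLUTE and `K = K(κ, C₁, c₅)`. [cite: HeathBrownActa2001, Lemma 12.2, §13 p. 83] -/
theorem SV_le_of_params :
    ∃ c₀ : ℝ, 0 ≤ c₀ ∧ ∀ κ C₁ c₅ : ℝ, 0 < κ → 0 < c₅ → ∃ Kc : ℝ, 0 < Kc ∧
      ∀ (X η τ V T Y Q₁ c₁ W : ℝ) (nn : ℕ) (m : Fin (nn + 1) → ℕ) (cR : Ideal (𝓞 K) → ℝ),
        0 ≤ η → η ≤ 1 → 0 < τ → τ ≤ 1 → CoreAdmissible τ m → Hyp314 X τ m Q₁ C₁ c₁ 3 1 → CSupport X τ cR →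
        2 ≤ X → 1 ≤ Real.log X → 1 ≤ Y → 1 ≤ Q₁ → Q₁ ≤ X → 2 ≤ T → T ^ 3 = V → T ≤ X → T ^ 2 ≤ 56 * X →
        W = X ^ (τ / 2) → X * W ≤ T ^ 3 → T ^ 2 * W ≤ X → Y ^ 10 * Q₁ ≤ T ^ 2 → c₅ * X * Y ^ 3 ≤ T ^ 3 → Y ≤ X →
        Q₁ ^ (1 / 3 : ℝ) * Real.exp (-(c₁ * Real.sqrt (Real.log (hbL X τ)))) ≤ 1 →
        2 ≤ T / ((1248 * (⌊Y⌋₊ + 1) ^ 2 : ℕ) : ℝ) →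
        3 * (((1248 * (⌊Y⌋₊ + 1) ^ 2 : ℕ)) : ℝ) + 2 ≤ (T / ((1248 * (⌊Y⌋₊ + 1) ^ 2 : ℕ) : ℝ)) ^ 2 →
        hbL X τ ^ 2 ≤ T / ((1248 * (⌊Y⌋₊ + 1) ^ 2 : ℕ) : ℝ) → X ≤ 270 * V →
        270 * V / X ≤ κ * (T / ((1248 * (⌊Y⌋₊ + 1) ^ 2 : ℕ) : ℝ)) →
        1 ≤ V / (X * Y) → V / (X * Y) ≤ T → 1 ≤ T ^ 3 * Y ^ 7 / X →
        |bilin (boxPairs X η) pairIdeal cR (gCut X τ m V)| ≤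
          Kc * X ^ 2 * (Y ^ (-(1 / 2 : ℝ)) + Y ^ 30 * X ^ (-(τ / 4)) + Y ^ 8 * Q₁ ^ (-(1 / 8 : ℝ)) +
            Y ^ 8 * Q₁ ^ 2 * Real.exp (-(c₁ / 2 * Real.sqrt (Real.log (hbL X τ))))) * Real.log X ^ c₀ := by
  classical
  -- the absolute constants
  obtain ⟨CS, eS, hCS, heS, hS1⟩ := exists_S1_bound
  obtain ⟨CB, eB, hCB, hbox⟩ := exists_sum_box_idealDivisorCount_pow_le 2
  obtain ⟨C₂, e₂, hC₂, h45₂⟩ := exists_sum_latticeCube_idealDivisorCount_pow_le 2 (A := 3) (by norm_num)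
  obtain ⟨C₃, e₃, hC₃, h45₃⟩ := exists_sum_latticeCube_idealDivisorCount_pow_le 3 (A := 3) (by norm_num)
  obtain ⟨CT, eT, hCT, hTL⟩ := exists_TL_bound
  obtain ⟨CE, eE, hCE, heE, hErr⟩ := exists_errorEV_bound
  obtain ⟨E, hE⟩ : ∃ E : ℕ, 2 ^ (4 * (12 * 3 + 62) + 4) + 1 = E := ⟨_, rfl⟩
  set etot : ℝ := eS + (eB : ℝ) + eT + (E + 1 : ℕ) + (e₂ + 1 : ℕ) + (e₃ + 3 : ℕ) with hetot
  have hetot0 : 0 ≤ etot := by positivity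
  refine ⟨etot + eE, by positivity, fun κ C₁ c₅ hκ hc₅ => ?_⟩
  obtain ⟨C₁₁, hC₁₁, h11⟩ := HeathBrown2001_lemma_11_1 (A := 3) (by norm_num) hκ
  rw [hE] at h11
  -- the constant of `Ssum_le_of_params`
  set KS : ℝ := CS + 2 * 81 * 27 * 87808 * 4 ^ eB * CB + 162 * CT + 2 * 81 * 34000000000 * 12 * 9 ^ 5 * (2 + 3 / c₅) * C₁₁ +
      2 * 9 ^ 6 * 414720 * 11 * 81 * (16 + (19968 + 4992 ^ 3)) * C₂ +
      48 * 9 ^ 6 * (4992 ^ 6 * C₁ ^ 2 + 162 * 3 * (12 + (100 * 4992 ^ 2 + 16 * 4992 ^ 4)) * C₃ ^ (2 / 3 : ℝ)) with hKS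
  have hKS0 : 0 < KS := by
    have : 0 ≤ C₃ ^ (2 / 3 : ℝ) := Real.rpow_nonneg hC₃.le _
    positivity
  refine ⟨Real.sqrt (3375 * KS) + CE, by positivity, ?_⟩
  intro X η τ V T Y Q₁ c₁ W nn m cR hη0 hη1 hτ hτ1 hm hHyp hcR hX hlogX hY hQ₁ hQ₁X hT2 hTV hTX hT56 hW hXW hTW
    hYQ hc₅V hYX hQe hs2 hsN hsL hVX hκs hΔ1 hΔT hd₀
  have hX0 : 0 < X := by linarith
  have hT : 0 < T := by linarith
  have hT1 : 1 ≤ T := by linarith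
  have hY0 : 0 < Y := by linarith
  have hQ₁0 : 0 < Q₁ := by linarith
  have hV0 : 0 < V := by rw [← hTV]; positivity
  -- the bound for `S`
  have hSsum := Ssum_le_of_params (X := X) (η := η) (τ := τ) (V := V) (T := T) (Y := Y) (Q₁ := Q₁) (C₁ := C₁) (c₁ := c₁)
    (c₅ := c₅) (W := W) (m := m) hCS hCB hC₂ hC₃ hC₁₁ hCT heS
    (hS1 X η τ V T nn m hX hη0 hη1 hτ hτ1 hT hTV hm)
    (by simpa [Bbox, cube] using hbox (3 * T) (by linarith))
    h45₂ h45₃ h11 (hTL T _ hT2 hd₀) hη0 hη1 hτ hτ1 hm hHyp hc₅ hX hlogX hY hQ₁ hQ₁X hT1 hTV hTX hT56 hW hXW hTW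
    hYQ hc₅V hYX hQe hs2 hsN hsL hVX hκs hΔ1 hΔT hd₀
  rw [← hKS] at hSsum
  clear_value KS
  clear hKS
  -- `S_V = main + error`
  rw [bilin_eq_main_add_error (T := T) (η := η) hX0.le hT]
  refine (abs_add_le _ _).trans ?_
  -- the four terms
  obtain ⟨e₁, e₂', e₃', e₄⟩ := four_terms_sq (τ := τ) (c := c₁) (u := Real.sqrt (Real.log (hbL X τ))) hX0 hY0 hQ₁0
  set U : ℝ := Y⁻¹ + Y ^ 60 * X ^ (-(τ / 2)) + Y ^ 16 * Q₁ ^ (-(1 / 4 : ℝ)) +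
    Y ^ 16 * Q₁ ^ 4 * Real.exp (-(c₁ * Real.sqrt (Real.log (hbL X τ)))) with hU
  have hUt : U = (Y ^ (-(1 / 2 : ℝ))) ^ 2 + (Y ^ 30 * X ^ (-(τ / 4))) ^ 2 + (Y ^ 8 * Q₁ ^ (-(1 / 8 : ℝ))) ^ 2 +
      (Y ^ 8 * Q₁ ^ 2 * Real.exp (-(c₁ / 2 * Real.sqrt (Real.log (hbL X τ))))) ^ 2 := by
    rw [hU, e₁, e₂', e₃', e₄]
  have ht₁0 : 0 ≤ Y ^ (-(1 / 2 : ℝ)) := Real.rpow_nonneg hY0.le _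
  have ht₂0 : 0 ≤ Y ^ 30 * X ^ (-(τ / 4)) := mul_nonneg (by positivity) (Real.rpow_nonneg hX0.le _)
  have ht₃0 : 0 ≤ Y ^ 8 * Q₁ ^ (-(1 / 8 : ℝ)) := mul_nonneg (by positivity) (Real.rpow_nonneg hQ₁0.le _)
  have ht₄0 : 0 ≤ Y ^ 8 * Q₁ ^ 2 * Real.exp (-(c₁ / 2 * Real.sqrt (Real.log (hbL X τ)))) := by positivity
  have hU0 : 0 ≤ U := by rw [hUt]; positivity
  set St : ℝ := Y ^ (-(1 / 2 : ℝ)) + Y ^ 30 * X ^ (-(τ / 4)) + Y ^ 8 * Q₁ ^ (-(1 / 8 : ℝ)) +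
    Y ^ 8 * Q₁ ^ 2 * Real.exp (-(c₁ / 2 * Real.sqrt (Real.log (hbL X τ)))) with hSt
  have hsqrtU : Real.sqrt U ≤ St := by rw [hUt]; exact sqrt_sum_four_le ht₁0 ht₂0 ht₃0 ht₄0
  have hSt0 : 0 ≤ St := by positivity
  have ht₂St : X ^ (-(τ / 4)) ≤ St := by
    have h2 : X ^ (-(τ / 4)) ≤ Y ^ 30 * X ^ (-(τ / 4)) :=
      le_mul_of_one_le_left (Real.rpow_nonneg hX0.le _) (one_le_pow₀ hY)
    linarith
  -- logarithms
  set LX := Real.log X with hLX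
  have hLX0 : 0 ≤ LX := by linarith
  have hLpow : ∀ a b : ℝ, a ≤ b → LX ^ a ≤ LX ^ b := fun a b hab => Real.rpow_le_rpow_of_exponent_le hlogX hab
  have hLge1 : ∀ a : ℝ, 0 ≤ a → 1 ≤ LX ^ a := fun a ha => Real.one_le_rpow hlogX ha
  -- the main term
  have hmain : |mainMV X τ m V T cR η| ≤ Real.sqrt (3375 * KS) * X ^ 2 * St * LX ^ (etot + eE) := by
    rw [mainMV_eq_sum_cA_innerSum hX0 hη1 hT hTV]
    refine (abs_sum_cA_innerSum_le hcR).trans ?_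
    have hA : (#(Abox X T) : ℝ) ≤ (15 * X / T) ^ 3 := by
      refine (card_Abox_le hX0.le hT).trans ?_
      have : 14 * X / T + 1 ≤ 15 * X / T := by
        rw [div_add_one hT.ne', div_le_div_iff_of_pos_right hT]; linarith
      exact pow_le_pow_left₀ (by positivity) this 3
    have h1 : Real.sqrt (#(Abox X T)) * Real.sqrt (Ssum X η τ m V T) ≤
        Real.sqrt ((15 * X / T) ^ 3) * Real.sqrt (KS * (X * V) * U * LX ^ etot) :=
      mul_le_mul (Real.sqrt_le_sqrt hA) (Real.sqrt_le_sqrt hSsum) (Real.sqrt_nonneg _) (Real.sqrt_nonneg _)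
    refine h1.trans ?_
    rw [← Real.sqrt_mul (by positivity)]
    have e : (15 * X / T) ^ 3 * (KS * (X * V) * U * LX ^ etot) = (3375 * KS) * (X ^ 2) ^ 2 * (U * LX ^ etot) := by
      rw [← hTV]; field_simp; ring
    rw [e, Real.sqrt_mul (by positivity), Real.sqrt_mul (by positivity), Real.sqrt_sq (by positivity),
      Real.sqrt_mul hU0]
    have hL1 : Real.sqrt (LX ^ etot) ≤ LX ^ (etot + eE) := by
      rw [Real.sqrt_eq_rpow, ← Real.rpow_mul hLX0]
      exact Real.rpow_le_rpow_of_exponent_le hlogX (by linarith)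
    have hL0 : 0 ≤ Real.sqrt (LX ^ etot) := Real.sqrt_nonneg _
    calc Real.sqrt (3375 * KS) * X ^ 2 * (Real.sqrt U * Real.sqrt (LX ^ etot))
        ≤ Real.sqrt (3375 * KS) * X ^ 2 * (St * LX ^ (etot + eE)) := by gcongr
      _ = _ := by ring
  -- the error term
  have herr : |errorEV X τ m V T cR η| ≤ CE * X ^ 2 * St * LX ^ (etot + eE) := by
    have h := hErr X η τ V T nn m cR hX hη0 hη1 hτ hτ1 hT hm hcR
    have hXt : (X ^ τ) ^ (-(1 / 2 : ℝ)) ≤ St := by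
      have e : (X ^ τ) ^ (-(1 / 2 : ℝ)) = X ^ (-(τ / 2)) := by rw [← Real.rpow_mul hX0.le]; ring_nf
      rw [e]
      have h1 : X ^ (-(τ / 2)) ≤ X ^ (-(τ / 4)) := Real.rpow_le_rpow_of_exponent_le (by linarith) (by linarith)
      linarith
    have hX0' : 0 ≤ (X ^ τ) ^ (-(1 / 2 : ℝ)) := Real.rpow_nonneg (Real.rpow_nonneg hX0.le _) _
    calc |errorEV X τ m V T cR η| ≤ CE * X ^ 2 * (X ^ τ) ^ (-(1 / 2 : ℝ)) * LX ^ eE := h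
      _ ≤ CE * X ^ 2 * St * LX ^ (etot + eE) := by
          gcongr
          · linarith
  calc |mainMV X τ m V T cR η| + |errorEV X τ m V T cR η|
      ≤ Real.sqrt (3375 * KS) * X ^ 2 * St * LX ^ (etot + eE) + CE * X ^ 2 * St * LX ^ (etot + eE) := add_le_add hmain herr
    _ = (Real.sqrt (3375 * KS) + CE) * X ^ 2 * St * LX ^ (etot + eE) := by ring

/-! ### The parameter inequalities hold for `X ≥ X₀` -/

/-- `L^{1/3} ≤ L/9` for `L ≥ 27`. [folklore] -/
theorem rpow_third_le_div_nine {L : ℝ} (hL : 27 ≤ L) : L ^ (1 / 3 : ℝ) ≤ L / 9 := by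
  have hL0 : 0 ≤ L := by linarith
  set y := L ^ (1 / 3 : ℝ) with hy
  have hy0 : 0 ≤ y := Real.rpow_nonneg hL0 _
  have hy3 : y ^ 3 = L := by rw [hy, ← Real.rpow_natCast, ← Real.rpow_mul hL0]; norm_num
  have hy3' : 3 ≤ y := by
    by_contra h
    have h' : y < 3 := not_le.mp h
    have : y ^ 3 < 3 ^ 3 := pow_lt_pow_left₀ h' hy0 (by norm_num)
    linarith
  rw [le_div_iff₀ (by norm_num), ← hy3]
  have h9 : 9 ≤ y ^ 2 := by nlinarith
  calc y * 9 ≤ y * y ^ 2 := by gcongr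
    _ = y ^ 3 := by ring

/-- The eventual (in `X`) facts used in the proof of Lemma 3.10, with `L = log X`, `τ = (log L)^{−ϖ}`:
`X ≥ 2`, `L ≥ 1`, `0 < τ ≤ 1/8`, `K₅ ≤ X^{τ/6}`, `K₆ ≤ X^{1/6}`, `e^{L^{1/3}} X^{−1/3} ≤ c`,
`L^{1/3}/3 ≤ c₁√(τL/2)`. [folklore] -/
theorem eventually_final_params {ϖ : ℝ} (hϖ : 0 < ϖ) (K₅ K₆ : ℝ) {c₁ c : ℝ} (hc₁ : 0 < c₁) (hc : 0 < c) :
    ∀ᶠ X : ℝ in atTop,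
      2 ≤ X ∧ 1 ≤ Real.log X ∧ 0 < hbTau ϖ X ∧ hbTau ϖ X ≤ 1 / 8 ∧ K₅ ≤ X ^ (hbTau ϖ X / 6) ∧
        K₆ ≤ X ^ (1 / 6 : ℝ) ∧ Real.exp (Real.log X ^ (1 / 3 : ℝ)) * X ^ (-(1 / 3 : ℝ)) ≤ c ∧
        Real.log X ^ (1 / 3 : ℝ) / 3 ≤ c₁ * Real.sqrt (hbTau ϖ X * Real.log X / 2) := by
  have h8 : (0 : ℝ) < 8 := by norm_num
  filter_upwards [eventually_reduction_params ϖ hc₁,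
    (Real.tendsto_log_atTop.comp Real.tendsto_log_atTop).eventually (eventually_ge_atTop (max 1 ((8 : ℝ) ^ (1 / ϖ)))),
    eventually_loglog_rpow_le ϖ (6 * Real.log (max K₅ 1)) (by norm_num : (0 : ℝ) < 1),
    (tendsto_rpow_atTop (by norm_num : (0 : ℝ) < 1 / 6)).eventually (eventually_ge_atTop K₆),
    Real.tendsto_log_atTop.eventually (eventually_ge_atTop (max 27 (-(9 / 2) * Real.log c)))]
    with X hred hM hK₅ hK₆ hL27
  obtain ⟨hX2, hL1, hτpos, -, -, hC⟩ := hred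
  set L := Real.log X with hL
  set M := Real.log L with hMdef
  have hX0 : 0 < X := by linarith
  have hLpos : 0 < L := by linarith
  have hM1 : 1 ≤ M := le_trans (le_max_left _ _) hM
  have hMpos : 0 < M := by linarith
  have hτ : hbTau ϖ X = (M ^ ϖ)⁻¹ := by rw [hbTau, ← hL, ← hMdef, Real.rpow_neg hMpos.le]
  have hMϖ : 0 < M ^ ϖ := Real.rpow_pos_of_pos hMpos _
  refine ⟨hX2, hL1, hτpos, ?_, ?_, hK₆, ?_, ?_⟩
  · -- `τ ≤ 1/8` iff `8 ≤ M^ϖ`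
    have h1 : (8 : ℝ) ^ (1 / ϖ) ≤ M := le_trans (le_max_right _ _) hM
    have h88 : (8 : ℝ) ≤ M ^ ϖ := by
      calc (8 : ℝ) = ((8 : ℝ) ^ (1 / ϖ)) ^ ϖ := by
            rw [← Real.rpow_mul h8.le, one_div_mul_cancel hϖ.ne', Real.rpow_one]
        _ ≤ M ^ ϖ := Real.rpow_le_rpow (by positivity) h1 hϖ.le
    rw [hτ, show (1 : ℝ) / 8 = 8⁻¹ by norm_num]
    exact inv_anti₀ h8 h88
  · -- `K₅ ≤ X^{τ/6}` from `6 log(max K₅ 1) M^ϖ ≤ L`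
    have h1 : Real.log (max K₅ 1) ≤ hbTau ϖ X / 6 * L := by
      rw [Real.rpow_one] at hK₅
      rw [hτ, div_mul_eq_mul_div, le_div_iff₀ (by norm_num : (0:ℝ) < 6), inv_mul_eq_div, le_div_iff₀ hMϖ]
      linarith
    calc K₅ ≤ max K₅ 1 := le_max_left _ _
      _ = Real.exp (Real.log (max K₅ 1)) := (Real.exp_log (lt_of_lt_of_le one_pos (le_max_right _ _))).symm
      _ ≤ Real.exp (hbTau ϖ X / 6 * L) := Real.exp_le_exp.mpr h1
      _ = X ^ (hbTau ϖ X / 6) := by rw [Real.rpow_def_of_pos hX0, hL, mul_comm]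
  · -- `exp(L^{1/3}) X^{-1/3} ≤ c` from `L ≥ 27`, `L ≥ -(9/2) log c`
    have h27 : 27 ≤ L := le_trans (le_max_left _ _) hL27
    have hlc : -(9 / 2) * Real.log c ≤ L := le_trans (le_max_right _ _) hL27
    have h1 := rpow_third_le_div_nine h27
    rw [Real.rpow_def_of_pos hX0, ← hL, ← Real.exp_add]
    calc Real.exp (L ^ (1 / 3 : ℝ) + L * -(1 / 3 : ℝ)) ≤ Real.exp (Real.log c) := by
          apply Real.exp_le_exp.mpr; linarith
      _ = c := Real.exp_log hc
  · have h13 : 0 ≤ L ^ (1 / 3 : ℝ) := Real.rpow_nonneg hLpos.le _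
    linarith

/-- Exponent bookkeeping with `R = X^{1/6}`, `P = X^{τ/6}`: `X = R⁶`, `X^{1/2} = R³`, `X^{−1/3} = (R²)⁻¹`,
`X^{τ/3} = P²`, `X^{τ/2} = P³`, `X^τ = P⁶`, `X^{1+τ} = R⁶P⁶`, `X^{3/2−τ} = R⁹/P⁶`. [folklore] -/
theorem rpow_bookkeeping {X τ : ℝ} (hX : 0 < X) :
    X = (X ^ (1 / 6 : ℝ)) ^ 6 ∧ X ^ (-(1 / 3 : ℝ)) = ((X ^ (1 / 6 : ℝ)) ^ 2)⁻¹ ∧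
      X ^ (τ / 3) = (X ^ (τ / 6)) ^ 2 ∧ X ^ (τ / 2) = (X ^ (τ / 6)) ^ 3 ∧ X ^ τ = (X ^ (τ / 6)) ^ 6 ∧
      X ^ (1 + τ) = (X ^ (1 / 6 : ℝ)) ^ 6 * (X ^ (τ / 6)) ^ 6 ∧
      X ^ (3 / 2 - τ) = (X ^ (1 / 6 : ℝ)) ^ 9 / (X ^ (τ / 6)) ^ 6 := by
  have e : ∀ (a : ℝ) (n : ℕ), (X ^ a) ^ n = X ^ (a * n) := fun a n => by
    rw [← Real.rpow_natCast, ← Real.rpow_mul hX.le]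
  refine ⟨?_, ?_, ?_, ?_, ?_, ?_, ?_⟩
  · rw [e]; norm_num
  · rw [e, ← Real.rpow_neg hX.le]; norm_num
  · rw [e]; ring_nf
  · rw [e]; ring_nf
  · rw [e]; ring_nf
  · rw [e, e, ← Real.rpow_add hX]; ring_nf
  · rw [e, e, ← Real.rpow_sub hX]; ring_nf

/-- There is no admissible `𝐦` with `k = 0` (`(1+τ)/ξ ≤ ∑ mᵢ = 0` is impossible). [folklore] -/
theorem not_coreAdmissible_zero {τ : ℝ} (hτ : 0 < τ) (m : Fin 0 → ℕ) : ¬ CoreAdmissible τ m := by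
  rintro ⟨-, -, h, -⟩
  simp only [Finset.univ_eq_empty, Finset.sum_empty] at h
  have : 0 < (1 + τ) / hbXi τ := div_pos (by linarith) (hbXi_pos hτ)
  linarith

set_option maxHeartbeats 2000000 in
/-- **The parameter inequalities for `X ≥ X₀`**: with `T = V^{1/3}`, `N = 1248(⌊Y⌋₊+1)²`,
`a = c₅^{1/3}`, `b = c₆^{1/3}`, `κ = 270·4992·b² + 1`, all the hypotheses of `SV_le_of_params` follow from
the eventual facts of `eventually_final_params` and the ranges of `V, Y, Q₁`. [cite: HeathBrownActa2001, §13 p. 83] -/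
theorem final_param_ineqs {X τ V Y Q₁ c₁ c₅ c₆ : ℝ} (hX2 : 2 ≤ X) (hL1 : 1 ≤ Real.log X) (hτ0 : 0 < τ)
    (hτ8 : τ ≤ 1 / 8) (hc₅ : 0 < c₅) (hc₆ : 0 < c₆)
    (hP : (c₆ ^ (1 / 3 : ℝ)) ^ 2 + 1 / c₅ + 1 / (270 * c₅) + 1 ≤ X ^ (τ / 6))
    (hR : 2 / c₅ ^ (1 / 3 : ℝ) + c₆ ^ (1 / 3 : ℝ) + 2 * 4992 / c₅ ^ (1 / 3 : ℝ) +
      24960 * 4992 ^ 2 / (c₅ ^ (1 / 3 : ℝ)) ^ 2 + 4992 / c₅ ^ (1 / 3 : ℝ) + 1 ≤ X ^ (1 / 6 : ℝ))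
    (hE7 : Real.exp (Real.log X ^ (1 / 3 : ℝ)) * X ^ (-(1 / 3 : ℝ)) ≤ c₅ ^ (2 / 3 : ℝ))
    (hC8 : Real.log X ^ (1 / 3 : ℝ) / 3 ≤ c₁ * Real.sqrt (τ * Real.log X / 2))
    (hV1 : c₅ * X ^ (1 + τ) ≤ V) (hV2 : V ≤ c₆ * X ^ (3 / 2 - τ)) (hY1 : 1 ≤ Y) (hY2 : Y ≤ X ^ (τ / 3))
    (hQ₁ : 1 ≤ Q₁) (hQ₁2 : Q₁ ≤ Real.exp (Real.log X ^ (1 / 3 : ℝ))) :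
    Q₁ ≤ X ∧ 2 ≤ V ^ (1 / 3 : ℝ) ∧ (V ^ (1 / 3 : ℝ)) ^ 3 = V ∧ V ^ (1 / 3 : ℝ) ≤ X ∧
      (V ^ (1 / 3 : ℝ)) ^ 2 ≤ 56 * X ∧ X * X ^ (τ / 2) ≤ (V ^ (1 / 3 : ℝ)) ^ 3 ∧
      (V ^ (1 / 3 : ℝ)) ^ 2 * X ^ (τ / 2) ≤ X ∧ Y ^ 10 * Q₁ ≤ (V ^ (1 / 3 : ℝ)) ^ 2 ∧
      c₅ * X * Y ^ 3 ≤ (V ^ (1 / 3 : ℝ)) ^ 3 ∧ Y ≤ X ∧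
      Q₁ ^ (1 / 3 : ℝ) * Real.exp (-(c₁ * Real.sqrt (Real.log (hbL X τ)))) ≤ 1 ∧
      2 ≤ V ^ (1 / 3 : ℝ) / ((1248 * (⌊Y⌋₊ + 1) ^ 2 : ℕ) : ℝ) ∧
      3 * (((1248 * (⌊Y⌋₊ + 1) ^ 2 : ℕ)) : ℝ) + 2 ≤ (V ^ (1 / 3 : ℝ) / ((1248 * (⌊Y⌋₊ + 1) ^ 2 : ℕ) : ℝ)) ^ 2 ∧
      hbL X τ ^ 2 ≤ V ^ (1 / 3 : ℝ) / ((1248 * (⌊Y⌋₊ + 1) ^ 2 : ℕ) : ℝ) ∧ X ≤ 270 * V ∧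
      270 * V / X ≤ (270 * 4992 * (c₆ ^ (1 / 3 : ℝ)) ^ 2 + 1) * (V ^ (1 / 3 : ℝ) / ((1248 * (⌊Y⌋₊ + 1) ^ 2 : ℕ) : ℝ)) ∧
      1 ≤ V / (X * Y) ∧ V / (X * Y) ≤ V ^ (1 / 3 : ℝ) ∧ 1 ≤ (V ^ (1 / 3 : ℝ)) ^ 3 * Y ^ 7 / X := by
  set a : ℝ := c₅ ^ (1 / 3 : ℝ) with ha
  set b : ℝ := c₆ ^ (1 / 3 : ℝ) with hb
  set L := Real.log X with hL
  have hX0 : 0 < X := by linarith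
  have hX1 : 1 ≤ X := by linarith
  have ha0 : 0 < a := Real.rpow_pos_of_pos hc₅ _
  have hb0 : 0 < b := Real.rpow_pos_of_pos hc₆ _
  have ha3 : a ^ 3 = c₅ := by rw [ha, ← Real.rpow_natCast, ← Real.rpow_mul hc₅.le]; norm_num
  have hb3 : b ^ 3 = c₆ := by rw [hb, ← Real.rpow_natCast, ← Real.rpow_mul hc₆.le]; norm_num
  have ha2 : a ^ 2 = c₅ ^ (2 / 3 : ℝ) := by rw [ha, ← Real.rpow_natCast, ← Real.rpow_mul hc₅.le]; norm_num
  set κ : ℝ := 270 * 4992 * b ^ 2 + 1 with hκ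
  have hκ0 : 0 < κ := by positivity
  clear_value a b L κ
  -- `R = X^{1/6}`, `P = X^{τ/6}`
  obtain ⟨eX, eX13, eτ3, eτ2, eτ, e1τ, e32τ⟩ := rpow_bookkeeping (τ := τ) hX0
  set R : ℝ := X ^ (1 / 6 : ℝ) with hRdef
  set P : ℝ := X ^ (τ / 6) with hPdef
  have hR0 : 0 < R := Real.rpow_pos_of_pos hX0 _
  have hP0 : 0 < P := Real.rpow_pos_of_pos hX0 _
  clear_value R P
  have hK₅P : b ^ 2 ≤ P ∧ 1 / c₅ ≤ P ∧ 1 / (270 * c₅) ≤ P ∧ 1 ≤ P := by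
    have h1 : 0 ≤ b ^ 2 := sq_nonneg _
    have h2 : 0 ≤ 1 / c₅ := by positivity
    have h3 : 0 ≤ 1 / (270 * c₅) := by positivity
    refine ⟨?_, ?_, ?_, ?_⟩ <;> linarith
  obtain ⟨hbP, hc₅P, hc₅P', hP1⟩ := hK₅P
  have hK₆R : 2 / a ≤ R ∧ b ≤ R ∧ 2 * 4992 / a ≤ R ∧ 24960 * 4992 ^ 2 / a ^ 2 ≤ R ∧ 4992 / a ≤ R ∧ 1 ≤ R := by
    have h1 : 0 ≤ 2 / a := by positivity
    have h2 : 0 ≤ 2 * 4992 / a := by positivity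
    have h3 : 0 ≤ 24960 * 4992 ^ 2 / a ^ 2 := by positivity
    have h4 : 0 ≤ 4992 / a := by positivity
    refine ⟨?_, ?_, ?_, ?_, ?_, ?_⟩ <;> linarith
  obtain ⟨hR2a, hRb, hR2, hR3, hR4, hR1⟩ := hK₆R
  have hQexp : Real.exp (L ^ (1 / 3 : ℝ)) ≤ a ^ 2 * R ^ 2 := by
    have h7 := hE7
    rw [eX13, ← ha2, mul_inv_le_iff₀ (by positivity)] at h7
    exact h7
  clear hE7 hP hR
  -- `T = V^{1/3}`
  have hV0 : 0 < V := lt_of_lt_of_le (by positivity) hV1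
  set T : ℝ := V ^ (1 / 3 : ℝ) with hTdef
  have hT0 : 0 < T := Real.rpow_pos_of_pos hV0 _
  have hTV : T ^ 3 = V := by rw [hTdef, ← Real.rpow_natCast, ← Real.rpow_mul hV0.le]; norm_num
  clear_value T
  have hVlo : (a * R ^ 2 * P ^ 2) ^ 3 ≤ T ^ 3 := by
    rw [hTV]
    calc (a * R ^ 2 * P ^ 2) ^ 3 = a ^ 3 * (R ^ 6 * P ^ 6) := by ring
      _ = c₅ * X ^ (1 + τ) := by rw [ha3, e1τ]
      _ ≤ V := hV1
  have hVhi : T ^ 3 ≤ (b * R ^ 3 / P ^ 2) ^ 3 := by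
    rw [hTV]
    calc V ≤ c₆ * X ^ (3 / 2 - τ) := hV2
      _ = (b * R ^ 3 / P ^ 2) ^ 3 := by rw [← hb3, e32τ]; field_simp
  have hTlo : a * R ^ 2 * P ^ 2 ≤ T := le_of_pow_le_pow_left₀ (by norm_num) hT0.le hVlo
  have hThi : T ≤ b * R ^ 3 / P ^ 2 := le_of_pow_le_pow_left₀ (by norm_num) (by positivity) hVhi
  have hT2hi : T ^ 2 ≤ b ^ 2 * R ^ 6 / P ^ 4 := by
    calc T ^ 2 ≤ (b * R ^ 3 / P ^ 2) ^ 2 := pow_le_pow_left₀ hT0.le hThi 2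
      _ = b ^ 2 * R ^ 6 / P ^ 4 := by field_simp
  have hT2lo : a ^ 2 * R ^ 4 * P ^ 4 ≤ T ^ 2 := by
    calc a ^ 2 * R ^ 4 * P ^ 4 = (a * R ^ 2 * P ^ 2) ^ 2 := by ring
      _ ≤ T ^ 2 := pow_le_pow_left₀ (by positivity) hTlo 2
  -- `P`-powers against `R` (τ ≤ 1/8): `P⁸ ≤ R`, `P¹⁶ ≤ R²`, and `P² ≤ P⁸`
  have hP8 : P ^ 8 ≤ R := by
    rw [hPdef, hRdef, ← Real.rpow_natCast, ← Real.rpow_mul hX0.le]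
    exact Real.rpow_le_rpow_of_exponent_le hX1 (by push_cast; linarith)
  have hP16 : P ^ 16 ≤ R ^ 2 := by
    calc P ^ 16 = (P ^ 8) ^ 2 := by ring
      _ ≤ R ^ 2 := pow_le_pow_left₀ (by positivity) hP8 2
  have hP28 : P ^ 2 ≤ P ^ 8 := pow_le_pow_right₀ hP1 (by norm_num)
  have hP4 : P ≤ P ^ 4 := le_self_pow₀ hP1 (by norm_num)
  have hP3 : P ≤ P ^ 3 := le_self_pow₀ hP1 (by norm_num)
  -- `N`
  obtain ⟨hN1248, hNY, hN4992⟩ := N_param_facts hY1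
  set Nn : ℕ := 1248 * (⌊Y⌋₊ + 1) ^ 2 with hNn
  have hN0 : (0 : ℝ) < (Nn : ℝ) := by exact_mod_cast lt_of_lt_of_le (by norm_num) hN1248
  clear_value Nn
  have hY0 : 0 < Y := by linarith
  have hYP : Y ≤ P ^ 2 := by rw [← eτ3]; exact hY2
  have hNP : (Nn : ℝ) ≤ 4992 * P ^ 4 := by
    calc (Nn : ℝ) ≤ 4992 * Y ^ 2 := hN4992
      _ ≤ 4992 * (P ^ 2) ^ 2 := by gcongr
      _ = 4992 * P ^ 4 := by ring
  -- `T/N ≥ a R²/(4992 P²)`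
  have hs : a * R ^ 2 / (4992 * P ^ 2) ≤ T / Nn := by
    rw [div_le_div_iff₀ (by positivity) hN0]
    calc a * R ^ 2 * Nn ≤ a * R ^ 2 * (4992 * P ^ 4) := by gcongr
      _ = (a * R ^ 2 * P ^ 2) * (4992 * P ^ 2) := by ring
      _ ≤ T * (4992 * P ^ 2) := by gcongr
  -- the hypotheses of `SV_le_of_params`
  have hτ1 : τ ≤ 1 := by linarith
  have hQ₁X : Q₁ ≤ X := by
    refine hQ₁2.trans ?_
    calc Real.exp (L ^ (1 / 3 : ℝ)) ≤ Real.exp L := by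
          apply Real.exp_le_exp.mpr
          calc L ^ (1 / 3 : ℝ) ≤ L ^ (1 : ℝ) := Real.rpow_le_rpow_of_exponent_le hL1 (by norm_num)
            _ = L := Real.rpow_one L
      _ = X := by rw [hL, Real.exp_log hX0]
  have hT2 : 2 ≤ T := by
    calc (2 : ℝ) = a * (2 / a) := by field_simp
      _ ≤ a * R := by gcongr
      _ ≤ a * R ^ 2 * P ^ 2 := by
          have h1 : R ≤ R ^ 2 := le_self_pow₀ hR1 (by norm_num)
          have h2 : R ^ 2 ≤ R ^ 2 * P ^ 2 := le_mul_of_one_le_right (sq_nonneg _) (one_le_pow₀ hP1)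
          calc a * R ≤ a * (R ^ 2 * P ^ 2) := mul_le_mul_of_nonneg_left (h1.trans h2) ha0.le
            _ = a * R ^ 2 * P ^ 2 := by ring
      _ ≤ T := hTlo
  have hTX : T ≤ X := by
    calc T ≤ b * R ^ 3 / P ^ 2 := hThi
      _ ≤ b * R ^ 3 := div_le_self (by positivity) (one_le_pow₀ hP1)
      _ ≤ R * R ^ 3 := by gcongr
      _ = R ^ 4 := by ring
      _ ≤ R ^ 6 := pow_le_pow_right₀ hR1 (by norm_num)
      _ = X := eX.symm
  have hT2W : T ^ 2 * P ^ 3 ≤ X := by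
    calc T ^ 2 * P ^ 3 ≤ b ^ 2 * R ^ 6 / P ^ 4 * P ^ 3 := by gcongr
      _ = b ^ 2 * R ^ 6 / P := by field_simp
      _ ≤ P * R ^ 6 / P := by gcongr
      _ = X := by rw [eX]; field_simp
  have hT56 : T ^ 2 ≤ 56 * X := by
    have : T ^ 2 ≤ T ^ 2 * P ^ 3 := le_mul_of_one_le_right (sq_nonneg _) (one_le_pow₀ hP1)
    linarith [hX0.le]
  have hXW : X * P ^ 3 ≤ T ^ 3 := by
    calc X * P ^ 3 = R ^ 6 * P ^ 3 := by rw [← eX]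
      _ ≤ R ^ 6 * P ^ 3 * (c₅ * P) := le_mul_of_one_le_right (by positivity) (by
          rw [div_le_iff₀ hc₅] at hc₅P; linarith)
      _ ≤ R ^ 6 * P ^ 3 * (c₅ * P ^ 3) := by gcongr
      _ = (a * R ^ 2 * P ^ 2) ^ 3 := by rw [← ha3]; ring
      _ ≤ T ^ 3 := hVlo
  have hYQ : Y ^ 10 * Q₁ ≤ T ^ 2 := by
    have hQ : Q₁ ≤ a ^ 2 * R ^ 2 := hQ₁2.trans hQexp
    calc Y ^ 10 * Q₁ ≤ (P ^ 2) ^ 10 * (a ^ 2 * R ^ 2) := by gcongr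
      _ = a ^ 2 * P ^ 4 * P ^ 16 * R ^ 2 := by ring
      _ ≤ a ^ 2 * P ^ 4 * R ^ 2 * R ^ 2 := by gcongr
      _ = a ^ 2 * R ^ 4 * P ^ 4 := by ring
      _ ≤ T ^ 2 := hT2lo
  have hc₅V : c₅ * X * Y ^ 3 ≤ T ^ 3 := by
    calc c₅ * X * Y ^ 3 ≤ c₅ * X * (P ^ 2) ^ 3 := by gcongr
      _ = c₅ * X ^ (1 + τ) := by rw [e1τ, ← eX]; ring
      _ ≤ V := hV1
      _ = T ^ 3 := hTV.symm
  have hYX : Y ≤ X := by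
    refine hY2.trans ?_
    calc X ^ (τ / 3) ≤ X ^ (1 : ℝ) := Real.rpow_le_rpow_of_exponent_le hX1 (by linarith)
      _ = X := Real.rpow_one X
  have hQe : Q₁ ^ (1 / 3 : ℝ) * Real.exp (-(c₁ * Real.sqrt (Real.log (hbL X τ)))) ≤ 1 := by
    have hlogL : Real.log (hbL X τ) = τ * L / 2 := by
      rw [hbL, Real.log_rpow hX0, ← hL]; ring
    rw [hlogL]
    have h1 : Q₁ ^ (1 / 3 : ℝ) ≤ Real.exp (L ^ (1 / 3 : ℝ) / 3) := by
      calc Q₁ ^ (1 / 3 : ℝ) ≤ (Real.exp (L ^ (1 / 3 : ℝ))) ^ (1 / 3 : ℝ) :=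
            Real.rpow_le_rpow (by linarith) hQ₁2 (by norm_num)
        _ = Real.exp (L ^ (1 / 3 : ℝ) / 3) := by rw [← Real.exp_mul]; ring_nf
    have h2 : Real.exp (L ^ (1 / 3 : ℝ) / 3) * Real.exp (-(c₁ * Real.sqrt (τ * L / 2))) ≤ 1 := by
      rw [← Real.exp_add, Real.exp_le_one_iff]; linarith
    exact le_trans (mul_le_mul_of_nonneg_right h1 (Real.exp_pos _).le) h2
  have hs2 : 2 ≤ T / Nn := by
    refine le_trans ?_ hs
    rw [le_div_iff₀ (by positivity)]
    calc 2 * (4992 * P ^ 2) ≤ 2 * (4992 * R) := by linarith [hP28.trans hP8]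
      _ = (2 * 4992 / a) * a * R := by field_simp
      _ ≤ R * a * R := by gcongr
      _ = a * R ^ 2 := by ring
  have hsN : 3 * (Nn : ℝ) + 2 ≤ (T / Nn) ^ 2 := by
    have h1 : 3 * (Nn : ℝ) + 2 ≤ 24960 * P ^ 4 := by
      have : (1248 : ℝ) ≤ Nn := by exact_mod_cast hN1248
      linarith
    have h2 : (a * R ^ 2 / (4992 * P ^ 2)) ^ 2 ≤ (T / Nn) ^ 2 := pow_le_pow_left₀ (by positivity) hs 2
    refine le_trans ?_ h2
    rw [div_pow, le_div_iff₀ (by positivity)]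
    -- `24960 P⁴ (4992 P²)² ≤ a² R⁴` from `P⁸ ≤ R` and `24960·4992² / a² ≤ R`
    have h3 : 24960 * 4992 ^ 2 * P ^ 8 ≤ a ^ 2 * R ^ 4 := by
      calc 24960 * 4992 ^ 2 * P ^ 8 ≤ 24960 * 4992 ^ 2 * R := by gcongr
        _ = (24960 * 4992 ^ 2 / a ^ 2) * a ^ 2 * R := by field_simp
        _ ≤ R * a ^ 2 * R := by gcongr
        _ = a ^ 2 * R ^ 2 := by ring
        _ ≤ a ^ 2 * R ^ 4 := by
            have : R ^ 2 ≤ R ^ 4 := pow_le_pow_right₀ hR1 (by norm_num)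
            exact mul_le_mul_of_nonneg_left this (sq_nonneg a)
    calc (3 * (Nn : ℝ) + 2) * (4992 * P ^ 2) ^ 2 ≤ 24960 * P ^ 4 * (4992 * P ^ 2) ^ 2 := by gcongr
      _ = 24960 * 4992 ^ 2 * P ^ 8 := by ring
      _ ≤ a ^ 2 * R ^ 4 := h3
      _ = (a * R ^ 2) ^ 2 := by ring
  have hsL : hbL X τ ^ 2 ≤ T / Nn := by
    have e : hbL X τ ^ 2 = P ^ 6 := by
      rw [hbL, eτ2]; ring
    rw [e]
    refine le_trans ?_ hs
    rw [le_div_iff₀ (by positivity)]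
    calc P ^ 6 * (4992 * P ^ 2) = 4992 * P ^ 8 := by ring
      _ ≤ 4992 * R := by gcongr
      _ = (4992 / a) * a * R := by field_simp
      _ ≤ R * a * R := by gcongr
      _ = a * R ^ 2 := by ring
  have hVX : X ≤ 270 * V := by
    calc X ≤ X * (270 * c₅ * P) := le_mul_of_one_le_right hX0.le (by
          rw [div_le_iff₀ (by positivity)] at hc₅P'; linarith)
      _ ≤ X * (270 * c₅ * P ^ 6) := by gcongr; exact le_self_pow₀ hP1 (by norm_num)
      _ = 270 * (c₅ * X ^ (1 + τ)) := by rw [e1τ, ← eX]; ring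
      _ ≤ 270 * V := by linarith
  have hκs : 270 * V / X ≤ κ * (T / Nn) := by
    have h1 : T / (4992 * P ^ 4) ≤ T / Nn := div_le_div_of_nonneg_left hT0.le hN0 hNP
    have h2 : 270 * V / X ≤ κ * (T / (4992 * P ^ 4)) := by
      rw [← hTV, div_le_iff₀ hX0, mul_div_assoc', div_mul_eq_mul_div, le_div_iff₀ (by positivity)]
      -- `270 T³ · 4992 P⁴ ≤ κ T X`
      have h3 : T ^ 2 * P ^ 4 ≤ b ^ 2 * X := by
        calc T ^ 2 * P ^ 4 ≤ b ^ 2 * R ^ 6 / P ^ 4 * P ^ 4 := by gcongr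
          _ = b ^ 2 * X := by rw [eX]; field_simp
      calc 270 * T ^ 3 * (4992 * P ^ 4) = 270 * 4992 * T * (T ^ 2 * P ^ 4) := by ring
        _ ≤ 270 * 4992 * T * (b ^ 2 * X) := by gcongr
        _ ≤ κ * T * X := by
            rw [hκ]
            have hTX0 : 0 ≤ T * X := by positivity
            have e : (270 * 4992 * b ^ 2 + 1) * T * X = 270 * 4992 * T * (b ^ 2 * X) + T * X := by ring
            rw [e]; linarith
    exact h2.trans (mul_le_mul_of_nonneg_left h1 hκ0.le)
  have hVlo' : c₅ * X * P ^ 6 ≤ V := by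
    calc c₅ * X * P ^ 6 = c₅ * X ^ (1 + τ) := by rw [e1τ, ← eX]; ring
      _ ≤ V := hV1
  have hΔ1 : 1 ≤ V / (X * Y) := by
    rw [le_div_iff₀ (by positivity)]
    calc 1 * (X * Y) ≤ X * P ^ 2 := by rw [one_mul]; gcongr
      _ ≤ X * P ^ 2 * (c₅ * P) := le_mul_of_one_le_right (by positivity) (by
          rw [div_le_iff₀ hc₅] at hc₅P; linarith)
      _ ≤ X * P ^ 2 * (c₅ * P ^ 4) := by gcongr
      _ = c₅ * X * P ^ 6 := by ring
      _ ≤ V := hVlo'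
  have hΔT : V / (X * Y) ≤ T := by
    rw [div_le_iff₀ (by positivity), ← hTV]
    have h1 : T ^ 2 ≤ X := le_trans (le_mul_of_one_le_right (sq_nonneg _) (one_le_pow₀ hP1)) hT2W
    calc T ^ 3 = T * T ^ 2 := by ring
      _ ≤ T * X := by gcongr
      _ ≤ T * (X * Y) := by gcongr; exact le_mul_of_one_le_right hX0.le hY1
  have hd₀ : 1 ≤ T ^ 3 * Y ^ 7 / X := by
    rw [le_div_iff₀ hX0, hTV]
    calc 1 * X ≤ X * (c₅ * P) := by rw [one_mul]; exact le_mul_of_one_le_right hX0.le (by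
          rw [div_le_iff₀ hc₅] at hc₅P; linarith)
      _ ≤ X * (c₅ * P ^ 6) := by gcongr; exact le_self_pow₀ hP1 (by norm_num)
      _ = c₅ * X * P ^ 6 * 1 := by ring
      _ ≤ V * Y ^ 7 := mul_le_mul hVlo' (one_le_pow₀ hY1) (by norm_num) hV0.le
  exact ⟨hQ₁X, hT2, hTV, hTX, hT56, by rw [eτ2]; exact hXW, by rw [eτ2]; exact hT2W, hYQ, hc₅V, hYX, hQe, hs2, hsN,
    hsL, hVX, hκs, hΔ1, hΔT, hd₀⟩

/-! ### Lemma 3.10 -/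

set_option maxHeartbeats 2000000 in
open scoped Classical in
/-- **The bound of p. 83** (the hypothesis of `HeathBrown2001_lemma_3_10_of_SV_bound`):
`S_V ≤ C X²(Y^{−1/2} + Y³⁰X^{−τ/4} + Y⁸Q₁^{−1/8} + Y⁸Q₁²e^{−c₂√(log L)})(log X)^c` for `X ≥ X₀`,
`1 ≤ Y ≤ X^{τ/3}`, under (3.14) with `c₃ = 3`, `c₄ = 1`. [cite: HeathBrownActa2001, §13 p. 83] -/
theorem SV_bound_p83 : ∀ ϖ : ℝ, 0 < ϖ → ϖ < 1 / 5 →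
    ∃ c c₃ c₄ : ℝ, 0 < c₃ ∧ 0 < c₄ ∧ ∀ C₁ c₁ c₅ c₆ : ℝ, 0 < c₁ → 0 < c₅ → 0 < c₆ →
      ∃ C c₂ X₀ : ℝ, 0 < c₂ ∧ ∀ X η Q₁ Y : ℝ, X₀ ≤ X → Real.exp (-Real.log X ^ (1 / 3 : ℝ)) ≤ η →
        η ≤ 1 → 1 ≤ Q₁ → Q₁ ≤ Real.exp (Real.log X ^ (1 / 3 : ℝ)) → 1 ≤ Y →
          Y ≤ X ^ (hbTau ϖ X / 3) →
          (∀ (k' : ℕ) (m' : Fin k' → ℕ), CoreAdmissible (hbTau ϖ X) m' →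
            Hyp314 X (hbTau ϖ X) m' Q₁ C₁ c₁ c₃ c₄) →
            ∀ (k : ℕ) (m : Fin k → ℕ), CoreAdmissible (hbTau ϖ X) m →
              ∀ cR : Ideal (𝓞 K) → ℝ, CSupport X (hbTau ϖ X) cR →
                ∀ V : ℝ, c₅ * X ^ (1 + hbTau ϖ X) ≤ V → V ≤ c₆ * X ^ (3 / 2 - hbTau ϖ X) →
                  |bilin (boxPairs X η) pairIdeal cR
                      (fun S => if V < (Ideal.absNorm S : ℝ) ∧ (Ideal.absNorm S : ℝ) ≤ 2 * V then
                        fWeight X (hbTau ϖ X) m S else 0)| ≤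
                    C * X ^ 2 * (Y ^ (-(1 / 2 : ℝ)) + Y ^ 30 * X ^ (-(hbTau ϖ X / 4)) +
                      Y ^ 8 * Q₁ ^ (-(1 / 8 : ℝ)) +
                      Y ^ 8 * Q₁ ^ 2 * Real.exp (-(c₂ * Real.sqrt (Real.log (hbL X (hbTau ϖ X)))))) *
                      Real.log X ^ c := by
  intro ϖ hϖ0 _hϖ5
  obtain ⟨c₀, -, H⟩ := SV_le_of_params
  refine ⟨c₀, 3, 1, by norm_num, by norm_num, fun C₁ c₁ c₅ c₆ hc₁ hc₅ hc₆ => ?_⟩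
  have hκ0 : (0 : ℝ) < 270 * 4992 * (c₆ ^ (1 / 3 : ℝ)) ^ 2 + 1 := by positivity
  obtain ⟨Kc, hKc, HK⟩ := H _ C₁ c₅ hκ0 hc₅
  obtain ⟨X₀, hX₀⟩ := Filter.eventually_atTop.mp
    (eventually_final_params hϖ0 ((c₆ ^ (1 / 3 : ℝ)) ^ 2 + 1 / c₅ + 1 / (270 * c₅) + 1)
      (2 / c₅ ^ (1 / 3 : ℝ) + c₆ ^ (1 / 3 : ℝ) + 2 * 4992 / c₅ ^ (1 / 3 : ℝ) +
        24960 * 4992 ^ 2 / (c₅ ^ (1 / 3 : ℝ)) ^ 2 + 4992 / c₅ ^ (1 / 3 : ℝ) + 1) hc₁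
      (Real.rpow_pos_of_pos hc₅ (2 / 3 : ℝ)))
  refine ⟨Kc, c₁ / 2, X₀, by positivity, ?_⟩
  intro X η Q₁ Y hXX₀ hη1 hη2 hQ₁ hQ₁2 hY1 hY2 hHyp k m hm cR hcR V hV1 hV2
  obtain ⟨hX2, hL1, hτ0, hτ8, hP, hR, hE7, hC8⟩ := hX₀ X hXX₀
  -- no admissible `𝐦` with `k = 0`
  cases k with
  | zero => exact (not_coreAdmissible_zero hτ0 m hm).elim
  | succ n =>
  obtain ⟨hQ₁X, hT2, hTV, hTX, hT56, hXW, hT2W, hYQ, hc₅V, hYX, hQe, hs2, hsN, hsL, hVX, hκs, hΔ1, hΔT, hd₀⟩ :=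
    final_param_ineqs (c₁ := c₁) hX2 hL1 hτ0 hτ8 hc₅ hc₆ hP hR hE7 hC8 hV1 hV2 hY1 hY2 hQ₁ hQ₁2
  have hη0 : 0 ≤ η := le_trans (Real.exp_pos _).le hη1
  have hτ1 : hbTau ϖ X ≤ 1 := by linarith
  -- apply the core bound
  have hmain := HK X η (hbTau ϖ X) V (V ^ (1 / 3 : ℝ)) Y Q₁ c₁ (X ^ (hbTau ϖ X / 2)) n m cR hη0 hη2 hτ0 hτ1 hm
    (hHyp _ m hm) hcR hX2 hL1 hY1 hQ₁ hQ₁X hT2 hTV hTX hT56 rfl hXW hT2W hYQ hc₅V hYX hQe hs2 hsN hsL hVX hκs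
    hΔ1 hΔT hd₀
  have hg : (fun S : Ideal (𝓞 K) => if V < (Ideal.absNorm S : ℝ) ∧ (Ideal.absNorm S : ℝ) ≤ 2 * V then
      fWeight X (hbTau ϖ X) m S else 0) = gCut X (hbTau ϖ X) m V := by
    funext S; unfold gCut; congr 1
  rw [hg]
  exact hmain

open scoped Classical in
/-- **Heath-Brown's Lemma 3.10** (Acta Math. 186 (2001), p. 17; proved in §§11–13): for any
`ϖ ∈ (0, 1/5)` there are absolute `c, c₃, c₄` such that, under the hypothesis (3.14) for the cubes
`𝒞 = (a, a+S₀] × (b, b+S₀] × (c, c+S₀]` of side `S₀ ≥ L²`, `|a|,|b|,|c| ≤ c₃V^{1/3}`, `N ≥ c₄V` on `𝒞`,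
the Type II sum satisfies `∑_R c_R ∑_{V < N(S) ≤ 2V} f_S ≪ X² Q₁^{−1/160} (log X)^c` uniformly for
`X^{1+τ} ≪ V ≪ X^{3/2−τ}`, `1 ≤ Q₁ ≤ exp((log X)^{1/3})`, `exp(−(log X)^{1/3}) ≤ η ≤ 1`.
[cite: HeathBrownActa2001, Lemma 3.10] -/
theorem HeathBrown2001_lemma_3_10_holds : HeathBrown2001_lemma_3_10 :=
  HeathBrown2001_lemma_3_10_of_SV_bound SV_bound_p83

end Literature.NumberTheory.Sieve.CubicSieve

end
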